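import Summits.ABC.IUTFork.Conditional.WRowN3Whole
import Summits.ABC.IUTFork.Conditional.RefBandsExactType557832031250
import Summits.ABC.IUTFork.Conditional.RefBandsInhTypeBand557832031250
import Summits.ABC.IUTFork.Conditional.RefBandsExactType504423766399592448
import Summits.ABC.IUTFork.Conditional.RefBandsInhTypeBand504423766399592448
import Summits.ABC.IUTFork.Conditional.RefBandsExactType99794037551104
import Summits.ABC.IUTFork.Conditional.RefBandsInhTypeBand99794037551104Diff
import Summits.ABC.IUTFork.Conditional.RefBandsExactType1411792877634228
import Summits.ABC.IUTFork.Conditional.RefBandsInhTypeBand1411792877634228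
import Summits.ABC.IUTFork.Conditional.RefBandsExactType10023806115968
import Summits.ABC.IUTFork.Conditional.RefBandsInhTypeBand10023806115968
import Summits.ABC.IUTFork.Conditional.RefBandsExactType14321927484375
import Summits.ABC.IUTFork.Conditional.RefBandsInhTypeBand14321927484375
import Summits.ABC.IUTFork.Conditional.RefBandsExactType115966796875
import Summits.ABC.IUTFork.Conditional.RefBandsInhTypeBand115966796875
import Summits.ABC.IUTFork.Conditional.RefBandsExactType2707160810382798173125
import Summits.ABC.IUTFork.Conditional.RefBandsInhTypeBand2707160810382798173125
import Summits.ABC.IUTFork.Conditional.RefBandsExactType1025227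
import Summits.ABC.IUTFork.Conditional.RefBandsInhTypeBand1025227
import Summits.ABC.IUTFork.Conditional.RefBandsExactTypeLevels99794037551104
import Summits.ABC.IUTFork.Conditional.RefBandsExactTypeLevels2707160810382798173125
import Summits.ABC.IUTFork.Conditional.RefBandsInhTypeLevelsBand1025227
import HarnessLib

/-!
# N3 universe of record, K LINE, ONE NAME for the TYPE-SPLIT zones — «N3 TYPE-SPLIT BY LOCAL TYPE»: for the 9 WINDOW-TABLE N3 axes whose S_H
# verdict on the zone between `WRow.n3_whole_levels`'s refuted top `L₀` and inhabited floor `L⁺` DEPENDS ON THE LOCAL TYPE at one pole `P`, the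
# landed per-type halves under ONE theorem name: type `e ∣ a·l` at every place over `P` ⇒ S_H REFUTED ∀T (K-line shape) on `[Z, H] ∖ {P}`; type
# `e = b·l` ⇒ S_H INHABITED ∀T (licence for every realising idele pair) on `[L, ∞)` — BY NAME onto abc-iut-W-num-6's «W:TS-BANDS» theorems

PROOF-ONLY file (D-0012; 0 definitions, 0 `Prop` facts, no instance, no notation) of the abc-iut cell — branch C certificate seat abc-iut-C-cert-1
(gen 12), OFFER (ξ) «C:N3-K-TYPESPLIT-ONE-NAME» (the sequel of rows «C:N3-K-WHOLE-ONE-NAME» p556835 / «C:N3-K-WHOLE-LEVELS» p563781, whose 11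
TYPE-SPLIT axes keep a gap decided per local type under own names). TAKES NO SIDE on [IUTchIII] Cor. 3.12 (S. Mochizuki, *Inter-universal Teichmüller
theory III*, Cor. 3.12 pp. 173–174; Step (xi-f) p. 184) or on any author; «refuted / inhabited AS TYPED» over OUR sharp containers ≠ «in print».

THE TABLE `(λ, P, a, b, Z, H, L)` (9 rows = the TYPE-SPLIT axes #8 #12 #13 #16 #20 #21 #28 #30 #37 of `WRow.n3_whole` whose per-type halves share ONE
shape; `λ` = that table's column byte for byte): `P` = the pole at which the local type is bound, `a` / `b` = the REF-type / INH-type multipliers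
(`(15, 30)`, `(5, 10)` or `(3, 6)`), `[Z, H]` = the range of abc-iut-W-num-6's REF-type band `GenuineK.not_pilotKummerCompatHull_chosen_triple_<N>_typeband_of_<a>`
(`RefBandsExactType<N>`; with the `RefBandsExactTypeLevels<N>` singleton FOLDED on #13 (6131) and #30 (5645473) through two pure-ℕ lemmas below),
`L` = the floor of its INH-type band `WRow.licence_triple_<N>_typeband_e<b>` (`RefBandsInhTypeBand<N>`; `…_e6_diff` on #13; the `RefBandsInhTypeLevelsBand1025227`
singleton 839 FOLDED on #37). The local-type hypothesis is stated PARAMETRICALLY in `(P, a | b)` exactly as the per-axis theorems state it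
(`∀ x₀ : Fibre (.inr ⟨P, _⟩), absRamificationIdx P (kOf … P x₀) ∣ a·l`, resp. `= b·l`); per row it IS the landed theorem's `hloc` up to proof
irrelevance. READ WITH `WRow.n3_whole_levels` (v2 literal 85d9060c8302f12f): on each of these 9 axes every prime `l ≥ 7` other than the excluded
pole is decided ∀T AS TYPED either unconditionally (outside the zone) or GIVEN THE LOCAL TYPE AT `P` (inside: `H ≥` the last zone prime, `L ≤` the
first). NOT CLAIMED: which local type occurs at a genuine datum (nor that `e ∈ {a·l, b·l}` exhausts the types — other types, if any, are NOT covered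
here); admissibility / Szpiro-badness / (P6) / NON-EMPTINESS of the datum type or of either sub-class; anything about the 2 remaining TYPE-SPLIT axes
(#32 `73`-axis at `l = 19`, #33 `7¹¹·19`-axis: IsSquare-type predicates, own names). A packaging theorem discharges nothing and changes no census
count; typed ≠ proved; instantiated ≠ endorsed; no abc claim.
[cite: Mochizuki2012, IUTchI Def. 3.1 (b),(c) pp. 61–62, Ex. 3.2 (iv) p. 71; IUTchIII Cor. 3.12 Step (xi-d) p. 183, (xi-f) p. 184; IUTchIV Prop. 1.1 p. 9, Prop. 1.2 (i)(ii) p. 10, Prop. 1.4 (ii) p. 13, Cor. 2.2 (ii) proof (P5) p. 46] [cite: DupuyHilado2025, §3.3, §3.4, §4.9, §4.12] [claim: Mochizuki2012, status: disputed] for every IUT sentence quoted.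
-/

noncomputable section

open Set Function Metric NumberField IsDedekindDomain

namespace Summit.ABC.IUTFork.Conditional

open Thm311 Thm311.Real Cor312 Cor312Vol Cor312Prov Literature.IUT.LogThetaLattice Literature.IUT.LogVolume
  Literature.IUT.HodgeTheaters Literature.IUT.LogVolume.Cor22
open Literature.NumberTheory.NumberFields Literature.NumberTheory.GaloisRepresentations.Ultrametric
open Literature.NumberTheory.DiophantineGeometry Literature.NumberTheory.DiophantineGeometry.GenEll

/-- Arithmetic: a prime `6129 < l ≤ 6131` is the listed REF-type level of `RefBandsExactTypeLevels99794037551104`. [folklore] -/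
theorem WRow.n3TypeSplit_refLevel_99794037551104 {l : ℕ} (hl : l.Prime) (hlo : 6129 < l) (hhi : l ≤ 6131) : l ∈ [6131] := by
  interval_cases l <;> first | (simp; done) | (exfalso; norm_num at hl)

/-- Arithmetic: a prime `5645470 < l ≤ 5645473` is the listed REF-type level of `RefBandsExactTypeLevels2707160810382798173125`. [folklore] -/
theorem WRow.n3TypeSplit_refLevel_2707160810382798173125 {l : ℕ} (hl : l.Prime) (hlo : 5645470 < l) (hhi : l ≤ 5645473) : l ∈ [5645473] := by
  interval_cases l <;> first | (simp; done) | (exfalso; norm_num at hl)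

/-- Arithmetic: a prime `839 ≤ l < 841` is the listed INH-type level of `RefBandsInhTypeLevelsBand1025227`. [folklore] -/
theorem WRow.n3TypeSplit_inhLevel_1025227 {l : ℕ} (hl : l.Prime) (hlo : 839 ≤ l) (hhi : l < 841) : l ∈ ([839] : List ℕ) := by
  interval_cases l <;> first | (simp; done) | (exfalso; norm_num at hl)

/-- **«N3 TYPE-SPLIT BY LOCAL TYPE UNDER ONE THEOREM NAME» (K line).** For every row `(λ, P, a, b, Z, H, L)` of the 9-row list literal below,
every prime `l`, every genuine Θ-volume datum `T` over `(ratPoint λ, l)`: (1) if `Z ≤ l ≤ H`, `l ≠ P` and EVERY place of `K = F(E[l])` over `P`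
has absolute ramification index dividing `a·l`, S_H FAILS in the K-line shape (CHOSEN realising ideles, pinned q-reading) — conjunct (1) of
`WRow.n3_whole` VERBATIM behind the type hypothesis; (2) if `L ≤ l` and every place over `P` has index `= b·l`, S_H HOLDS:
`Thm311ToCor312.Licence` at `settingPrVolSharp (pilotDataOfK T.D T.K) …` for EVERY pair of realising Θ- and q-ideles — conjunct (2) of
`WRow.n3_whole` VERBATIM behind the type hypothesis. Dispatch BY NAME onto the landed «W:TS-BANDS» per-type theorems. Packaging — discharges
nothing; which type occurs is NOT claimed. [cite: Mochizuki2012, IUTchI Def. 3.1 (b),(c) pp. 61–62, Ex. 3.2 (iv) p. 71; IUTchIII Cor. 3.12 Step (xi-d) p. 183, (xi-f) p. 184; IUTchIV Prop. 1.1 p. 9, Prop. 1.2 (i)(ii) p. 10, Prop. 1.4 (ii) p. 13, Cor. 2.2 (ii) proof (P5) p. 46] [cite: DupuyHilado2025, §3.3, §3.4, §4.9, §4.12] [claim: Mochizuki2012, status: disputed] -/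
theorem WRow.n3_typeSplit {q : ℚ} {P a b Z H L l : ℕ}
    (hmem : (q, P, a, b, Z, H, L) ∈ ([(((2 * 5 ^ 10 * 13 ^ 4 : ℕ) : ℚ) / (11 ^ 8 * 109 ^ 2 * 3677 ^ 3 : ℕ), 31, 15, 30, 7, 3704, 1847), (((2 ^ 11 * 3 ^ 4 * 101 ^ 4 * 29221 : ℕ) : ℚ) / (5 ^ 15 * 17 * 53093 ^ 2 : ℕ), 13, 15, 30, 7, 1211942736, 605971349), (((2 ^ 12 * 13 ^ 3 * 223 ^ 3 : ℕ) : ℚ) / (5 ^ 15 * 179 ^ 4 * 2141 : ℕ), 97, 3, 6, 7, 6131, 4091), (((2 ^ 2 * 3 ^ 4 * 163 ^ 3 * 1006151 : ℕ) : ℚ) / (11 ^ 9 * 29 ^ 4 * 101 ^ 3 : ℕ), 43, 15, 30, 7, 804537078, 402268525), (((2 ^ 7 * 23 ^ 8 : ℕ) : ℚ) / (3 ^ 22 * 13 * 47 ^ 2 * 263 : ℕ), 19, 5, 10, 7, 46891, 23439), (((3 * 5 ^ 6 * 7 ^ 8 * 53 : ℕ) : ℚ) / (2 * 11 ^ 6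 * 193 ^ 4 * 20551 : ℕ), 167, 5, 10, 7, 307414709, 153707347), (((5 ^ 14 * 19 : ℕ) : ℚ) / (11 ^ 7 * 37 ^ 2 * 353 : ℕ), 7, 15, 30, 7, 11735, 5857), (((5 ^ 4 * 19 ^ 13 * 103 : ℕ) : ℚ) / (3 ^ 19 * 11 ^ 4 * 463 ^ 5 : ℕ), 19, 15, 30, 7, 5645473, 2822723), (((7 ^ 5 * 61 : ℕ) : ℚ) / (3 ^ 13 * 5 ^ 8 * 11 ^ 3 * 53 * 73 ^ 2 * 89 ^ 2 * 103 : ℕ), 4229, 5, 10, 9, 1681, 839)] : List (ℚ × ℕ × ℕ × ℕ × ℕ × ℕ × ℕ)))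
    (hl : l.Prime) (hP : P.Prime) (T : Cor22.ThetaVolumeDatumAt (ratPoint q) l) :
    (Z ≤ l → l ≤ H → l ≠ P →
    letI := T.instFieldF; letI := T.instNumberFieldF; letI := T.instAlgebraF; letI := T.instFieldK
    letI := T.instNumberFieldK; letI := T.instAlgebraK; letI := T.instFieldFbar; letI := T.instAlgebraFbar
    letI := T.instAlgebraKFbar; letI := T.instIsElliptic
    (haveI : Fact (Nat.Prime P) := ⟨hP⟩
      ∀ x₀ : (thetaIndex (pilotDataOfK T.D T.K)).Fibre (.inr ⟨P, hP⟩),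
        absRamificationIdx P (kOf (pilotDataOfK T.D T.K) P x₀) ∣ a * l) →
    ∀ (M : Type) [Field M] [NumberField M]
      (archPk : ∀ (j : (thetaIndex (pilotDataOfK T.D T.K)).Label) (vQ : (thetaIndex (pilotDataOfK T.D T.K)).VQ),
        Set ((logShellsDH (pilotDataOfK T.D T.K) (analyticLogv T.K)).Packet j vQ))
      (archSub : ∀ (j : (thetaIndex (pilotDataOfK T.D T.K)).Label) (v : (thetaIndex (pilotDataOfK T.D T.K)).V),
        Set ((logShellsDH (pilotDataOfK T.D T.K) (analyticLogv T.K)).Packet j ((thetaIndex (pilotDataOfK T.D T.K)).over v)))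
      (Ψ : ℤ → ∀ v : (thetaIndex (pilotDataOfK T.D T.K)).V, v ∈ (thetaIndex (pilotDataOfK T.D T.K)).Vbad →
        Set ((logShellsDH (pilotDataOfK T.D T.K) (analyticLogv T.K)).StarPacket v))
      (act : ℤ → ∀ v : (thetaIndex (pilotDataOfK T.D T.K)).V, v ∈ (thetaIndex (pilotDataOfK T.D T.K)).Vbad →
        (logShellsDH (pilotDataOfK T.D T.K) (analyticLogv T.K)).StarPacket v →
          Module.End ℚ ((logShellsDH (pilotDataOfK T.D T.K) (analyticLogv T.K)).StarPacket v))
      (Mmod : ℤ → ∀ j : (thetaIndex (pilotDataOfK T.D T.K)).LabelStar, Set ((logShellsDH (pilotDataOfK T.D T.K) (analyticLogv T.K)).GlobalPacket j.1))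
      (region : ℤ → ∀ j : (thetaIndex (pilotDataOfK T.D T.K)).LabelStar, FinDivisor M → ∀ vQ : (thetaIndex (pilotDataOfK T.D T.K)).VQ,
        Set ((logShellsDH (pilotDataOfK T.D T.K) (analyticLogv T.K)).Packet j.1 vQ))
      (frobAdm : ℤ → ℤ → ∀ (j : (thetaIndex (pilotDataOfK T.D T.K)).Label) (vQ : (thetaIndex (pilotDataOfK T.D T.K)).VQ),
        Set ((logShellsDH (pilotDataOfK T.D T.K) (analyticLogv T.K)).Packet j vQ) → Prop)
      (frobLogvol : ℤ → ℤ → ∀ (j : (thetaIndex (pilotDataOfK T.D T.K)).Label) (vQ : (thetaIndex (pilotDataOfK T.D T.K)).VQ),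
        Set ((logShellsDH (pilotDataOfK T.D T.K) (analyticLogv T.K)).Packet j vQ) → ℝ)
      (frobΨ : ℤ → ℤ → ∀ v : (thetaIndex (pilotDataOfK T.D T.K)).V, v ∈ (thetaIndex (pilotDataOfK T.D T.K)).Vbad →
        Set ((logShellsDH (pilotDataOfK T.D T.K) (analyticLogv T.K)).StarPacket v))
      (frobMmod : ℤ → ℤ → ∀ j : (thetaIndex (pilotDataOfK T.D T.K)).LabelStar, Set ((logShellsDH (pilotDataOfK T.D T.K) (analyticLogv T.K)).GlobalPacket j.1))
      (unitImage : ℤ → ℤ → ℕ → ∀ (j : (thetaIndex (pilotDataOfK T.D T.K)).Label) (vQ : (thetaIndex (pilotDataOfK T.D T.K)).VQ),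
        Set ((logShellsDH (pilotDataOfK T.D T.K) (analyticLogv T.K)).Packet j vQ))
      (ballImage : ℤ → ℤ → ∀ (j : (thetaIndex (pilotDataOfK T.D T.K)).Label) (vQ : (thetaIndex (pilotDataOfK T.D T.K)).VQ),
        Set ((logShellsDH (pilotDataOfK T.D T.K) (analyticLogv T.K)).Packet j vQ))
      (thetaDiv : ℤ → ℤ → LgpDivisor M (thetaIndex (pilotDataOfK T.D T.K)).lstar)
      (n : ℤ) {HT : Type} {LogLink : HT → HT → Type} {IsFull : ∀ {s t : HT}, LogLink s t → Prop}
      (lat : LGPGaussianLogThetaLattice LogLink IsFull)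
      {Frd : Type} {IsoF : Frd → Frd → Type} {Ob : Frd → Type} {realify : Frd → Frd} {Strip : Type}
      {IsoS : Strip → Strip → Type} {Mv : ∀ v : (thetaIndex (pilotDataOfK T.D T.K)).V, v ∈ (thetaIndex (pilotDataOfK T.D T.K)).Vbad → Type}
      [∀ v h, Monoid (Mv v h)]
      (sig : GlobalLGPFrobenioidSignature (thetaIndex (pilotDataOfK T.D T.K)).lstar (thetaIndex (pilotDataOfK T.D T.K)).V
        (· ∈ (thetaIndex (pilotDataOfK T.D T.K)).Vbad) Frd IsoF Ob realify Strip IsoS Mv)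
      (split : SplittingMonoids Mv) {ObΔ : Type} {N : ∀ v : (thetaIndex (pilotDataOfK T.D T.K)).V, v ∈ (thetaIndex (pilotDataOfK T.D T.K)).Vbad → Type}
      [∀ v h, Monoid (N v h)] (qData : QPilotData ObΔ N)
      (qK : ∀ v : (thetaIndex (pilotDataOfK T.D T.K)).V, v ∈ (thetaIndex (pilotDataOfK T.D T.K)).Vbad →
        Set ((logShellsDH (pilotDataOfK T.D T.K) (analyticLogv T.K)).StarPacket v)),
      ¬ Cor312Vol.PilotKummerCompatHull
          (LatticeSituation.ofShells (logShellsDH (pilotDataOfK T.D T.K) (analyticLogv T.K)) M archPk archSub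
            (summandPiecesPr (pilotDataOfK T.D T.K) (logvAnalytic_analyticLogv (F := T.K))).Adm
            (summandPiecesPr (pilotDataOfK T.D T.K) (logvAnalytic_analyticLogv (F := T.K))).logvol Ψ act Mmod region frobAdm frobLogvol frobΨ
            frobMmod unitImage ballImage thetaDiv)
          (settingPrVolSharp (pilotDataOfK T.D T.K) (logvAnalytic_analyticLogv (F := T.K)) M archPk archSub Ψ act Mmod region n lat sig split qData
            (exists_realising_qIdeles_pilotDataOfK T.D).choose (exists_realising_thetaIdeles_pilotDataOfK T.D).choose
            (exists_realising_qIdeles_pilotDataOfK T.D).choose_spec.1 (exists_realising_qIdeles_pilotDataOfK T.D).choose_spec.2.1)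
          (fun _ => Cor312.Setting.qRegion
            (settingPrVolSharp (pilotDataOfK T.D T.K) (logvAnalytic_analyticLogv (F := T.K)) M archPk archSub Ψ act Mmod region n lat sig split qData
              (exists_realising_qIdeles_pilotDataOfK T.D).choose (exists_realising_thetaIdeles_pilotDataOfK T.D).choose
              (exists_realising_qIdeles_pilotDataOfK T.D).choose_spec.1 (exists_realising_qIdeles_pilotDataOfK T.D).choose_spec.2.1)) qK) ∧
    (L ≤ l →
    letI := T.instFieldF; letI := T.instNumberFieldF; letI := T.instAlgebraF; letI := T.instFieldK
    letI := T.instNumberFieldK; letI := T.instAlgebraK; letI := T.instFieldFbar; letI := T.instAlgebraFbar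
    letI := T.instAlgebraKFbar; letI := T.instIsElliptic
    (haveI : Fact (Nat.Prime P) := ⟨hP⟩
      ∀ x₀ : (thetaIndex (pilotDataOfK T.D T.K)).Fibre (.inr ⟨P, hP⟩),
        absRamificationIdx P (kOf (pilotDataOfK T.D T.K) P x₀) = b * l) →
    ∀ {logv : PadicLogs T.K} (hlog : LogvAnalytic logv) (M : Type) [Field M] [NumberField M]
      (archPk : ∀ (j : (thetaIndex (pilotDataOfK T.D T.K)).Label) (vQ : (thetaIndex (pilotDataOfK T.D T.K)).VQ),
        Set ((logShellsDH (pilotDataOfK T.D T.K) logv).Packet j vQ))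
      (archSub : ∀ (j : (thetaIndex (pilotDataOfK T.D T.K)).Label) (v : (thetaIndex (pilotDataOfK T.D T.K)).V),
        Set ((logShellsDH (pilotDataOfK T.D T.K) logv).Packet j ((thetaIndex (pilotDataOfK T.D T.K)).over v)))
      (Ψ : ℤ → ∀ v : (thetaIndex (pilotDataOfK T.D T.K)).V, v ∈ (thetaIndex (pilotDataOfK T.D T.K)).Vbad →
        Set ((logShellsDH (pilotDataOfK T.D T.K) logv).StarPacket v))
      (act : ℤ → ∀ v : (thetaIndex (pilotDataOfK T.D T.K)).V, v ∈ (thetaIndex (pilotDataOfK T.D T.K)).Vbad →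
        (logShellsDH (pilotDataOfK T.D T.K) logv).StarPacket v → Module.End ℚ ((logShellsDH (pilotDataOfK T.D T.K) logv).StarPacket v))
      (Mmod : ℤ → ∀ j : (thetaIndex (pilotDataOfK T.D T.K)).LabelStar, Set ((logShellsDH (pilotDataOfK T.D T.K) logv).GlobalPacket j.1))
      (region : ℤ → ∀ j : (thetaIndex (pilotDataOfK T.D T.K)).LabelStar, FinDivisor M → ∀ vQ : (thetaIndex (pilotDataOfK T.D T.K)).VQ,
        Set ((logShellsDH (pilotDataOfK T.D T.K) logv).Packet j.1 vQ))
      (n : ℤ) {HT : Type} {LogLink : HT → HT → Type} {IsFull : ∀ {s t : HT}, LogLink s t → Prop}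
      (lat : LGPGaussianLogThetaLattice LogLink IsFull)
      {Frd : Type} {IsoF : Frd → Frd → Type} {Ob : Frd → Type} {realify : Frd → Frd} {Strip : Type}
      {IsoS : Strip → Strip → Type} {Mv : ∀ v : (thetaIndex (pilotDataOfK T.D T.K)).V, v ∈ (thetaIndex (pilotDataOfK T.D T.K)).Vbad → Type}
      [∀ v h, Monoid (Mv v h)]
      (sig : GlobalLGPFrobenioidSignature (thetaIndex (pilotDataOfK T.D T.K)).lstar (thetaIndex (pilotDataOfK T.D T.K)).V
        (· ∈ (thetaIndex (pilotDataOfK T.D T.K)).Vbad) Frd IsoF Ob realify Strip IsoS Mv)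
      (split : SplittingMonoids Mv) {ObΔ : Type} {N : ∀ v : (thetaIndex (pilotDataOfK T.D T.K)).V, v ∈ (thetaIndex (pilotDataOfK T.D T.K)).Vbad → Type}
      [∀ v h, Monoid (N v h)] (qData : QPilotData ObΔ N)
      (tq : ∀ (pp : Nat.Primes) (x : (thetaIndex (pilotDataOfK T.D T.K)).Fibre (.inr pp)),
        haveI : Fact (pp : ℕ).Prime := ⟨pp.2⟩; kOf (pilotDataOfK T.D T.K) pp.1 x)
      (t : ∀ (pp : Nat.Primes) (_ : Fin (pilotDataOfK T.D T.K).lstar) (x : (thetaIndex (pilotDataOfK T.D T.K)).Fibre (.inr pp)),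
        haveI : Fact (pp : ℕ).Prime := ⟨pp.2⟩; kOf (pilotDataOfK T.D T.K) pp.1 x)
      (htq0 : ∀ pp x, tq pp x ≠ 0)
      (htq1 : ∀ (pp : Nat.Primes) (x : (thetaIndex (pilotDataOfK T.D T.K)).Fibre (.inr pp)),
        haveI : Fact (pp : ℕ).Prime := ⟨pp.2⟩; placeOf (pilotDataOfK T.D T.K) pp.1 x ∉ (pilotDataOfK T.D T.K).S → ‖tq pp x‖ = 1)
      (_ht0 : ∀ pp i x, t pp i x ≠ 0)
      (_ht : ∀ (pp : Nat.Primes) (i : Fin (pilotDataOfK T.D T.K).lstar) (x : (thetaIndex (pilotDataOfK T.D T.K)).Fibre (.inr pp)),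
        haveI : Fact (pp : ℕ).Prime := ⟨pp.2⟩
        Real.log ‖t pp i x‖ = -((pilotDataOfK T.D T.K).thetaPilot i (placeOf (pilotDataOfK T.D T.K) pp.1 x)) *
          logNorm T.K (placeOf (pilotDataOfK T.D T.K) pp.1 x) / localDegree T.K (placeOf (pilotDataOfK T.D T.K) pp.1 x))
      (_htq : ∀ (pp : Nat.Primes) (x : (thetaIndex (pilotDataOfK T.D T.K)).Fibre (.inr pp)),
        haveI : Fact (pp : ℕ).Prime := ⟨pp.2⟩
        Real.log ‖tq pp x‖ = -((pilotDataOfK T.D T.K).qPilot (placeOf (pilotDataOfK T.D T.K) pp.1 x)) *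
          logNorm T.K (placeOf (pilotDataOfK T.D T.K) pp.1 x) / localDegree T.K (placeOf (pilotDataOfK T.D T.K) pp.1 x)),
      Thm311ToCor312.Licence
        (settingPrVolSharp (pilotDataOfK T.D T.K) hlog M archPk archSub Ψ act Mmod region n lat sig split qData tq t htq0 htq1)) := by
  simp only [List.mem_cons, Prod.mk.injEq, List.not_mem_nil, or_false] at hmem
  rcases hmem with ⟨rfl, rfl, rfl, rfl, rfl, rfl, rfl⟩ | ⟨rfl, rfl, rfl, rfl, rfl, rfl, rfl⟩ | ⟨rfl, rfl, rfl, rfl, rfl, rfl, rfl⟩ | ⟨rfl, rfl, rfl, rfl, rfl, rfl, rfl⟩ | ⟨rfl, rfl, rfl, rfl, rfl, rfl, rfl⟩ | ⟨rfl, rfl, rfl, rfl, rfl, rfl, rfl⟩ | ⟨rfl, rfl, rfl, rfl, rfl, rfl, rfl⟩ | ⟨rfl, rfl, rfl, rfl, rfl, rfl, rfl⟩ | ⟨rfl, rfl, rfl, rfl, rfl, rfl, rfl⟩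

  · -- #8 N = 557832031250: pole P = 31; REF-type e ∣ 15·l on [7, 3704] ∖ {P}; INH-type e = 30·l on [1847, ∞)
    refine ⟨fun hZ hH hne hloc => ?_, fun hL hloc => ?_⟩
    · exact GenuineK.not_pilotKummerCompatHull_chosen_triple_557832031250_typeband_of_fifteen hl hZ hH hne T hloc
    · exact WRow.licence_triple_557832031250_typeband_e30 hl hL T hloc
  · -- #12 N = 504423766399592448: pole P = 13; REF-type e ∣ 15·l on [7, 1211942736] ∖ {P}; INH-type e = 30·l on [605971349, ∞)
    refine ⟨fun hZ hH hne hloc => ?_, fun hL hloc => ?_⟩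
    · exact GenuineK.not_pilotKummerCompatHull_chosen_triple_504423766399592448_typeband_of_fifteen hl hZ hH hne T hloc
    · exact WRow.licence_triple_504423766399592448_typeband_e30 hl hL T hloc
  · -- #13 N = 99794037551104: pole P = 97; REF-type e ∣ 3·l on [7, 6131] ∖ {P}; INH-type e = 6·l on [4091, ∞)
    refine ⟨fun hZ hH hne hloc => ?_, fun hL hloc => ?_⟩
    · rcases le_or_gt l 6129 with hB | hB
      · exact GenuineK.not_pilotKummerCompatHull_chosen_triple_99794037551104_typeband_of_three hl hZ hB hne T hloc
      · exact GenuineK.not_pilotKummerCompatHull_chosen_triple_99794037551104_typelevels_of_three hl (WRow.n3TypeSplit_refLevel_99794037551104 hl hB hH) hne T hloc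
    · exact WRow.licence_triple_99794037551104_typeband_e6_diff hl hL T hloc
  · -- #16 N = 1411792877634228: pole P = 43; REF-type e ∣ 15·l on [7, 804537078] ∖ {P}; INH-type e = 30·l on [402268525, ∞)
    refine ⟨fun hZ hH hne hloc => ?_, fun hL hloc => ?_⟩
    · exact GenuineK.not_pilotKummerCompatHull_chosen_triple_1411792877634228_typeband_of_fifteen hl hZ hH hne T hloc
    · exact WRow.licence_triple_1411792877634228_typeband_e30 hl hL T hloc
  · -- #20 N = 10023806115968: pole P = 19; REF-type e ∣ 5·l on [7, 46891] ∖ {P}; INH-type e = 10·l on [23439, ∞)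
    refine ⟨fun hZ hH hne hloc => ?_, fun hL hloc => ?_⟩
    · exact GenuineK.not_pilotKummerCompatHull_chosen_triple_10023806115968_typeband_of_five hl hZ hH hne T hloc
    · exact WRow.licence_triple_10023806115968_typeband_e10 hl hL T hloc
  · -- #21 N = 14321927484375: pole P = 167; REF-type e ∣ 5·l on [7, 307414709] ∖ {P}; INH-type e = 10·l on [153707347, ∞)
    refine ⟨fun hZ hH hne hloc => ?_, fun hL hloc => ?_⟩
    · exact GenuineK.not_pilotKummerCompatHull_chosen_triple_14321927484375_typeband_of_five hl hZ hH hne T hloc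
    · exact WRow.licence_triple_14321927484375_typeband_e10 hl hL T hloc
  · -- #28 N = 115966796875: pole P = 7; REF-type e ∣ 15·l on [7, 11735] ∖ {P}; INH-type e = 30·l on [5857, ∞)
    refine ⟨fun hZ hH hne hloc => ?_, fun hL hloc => ?_⟩
    · exact GenuineK.not_pilotKummerCompatHull_chosen_triple_115966796875_typeband_of_fifteen hl hZ hH hne T hloc
    · exact WRow.licence_triple_115966796875_typeband_e30 hl hL T hloc
  · -- #30 N = 2707160810382798173125: pole P = 19; REF-type e ∣ 15·l on [7, 5645473] ∖ {P}; INH-type e = 30·l on [2822723, ∞)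
    refine ⟨fun hZ hH hne hloc => ?_, fun hL hloc => ?_⟩
    · rcases le_or_gt l 5645470 with hB | hB
      · exact GenuineK.not_pilotKummerCompatHull_chosen_triple_2707160810382798173125_typeband_of_fifteen hl hZ hB hne T hloc
      · exact GenuineK.not_pilotKummerCompatHull_chosen_triple_2707160810382798173125_typelevels_of_fifteen hl (WRow.n3TypeSplit_refLevel_2707160810382798173125 hl hB hH) hne T hloc
    · exact WRow.licence_triple_2707160810382798173125_typeband_e30 hl hL T hloc
  · -- #37 N = 1025227: pole P = 4229; REF-type e ∣ 5·l on [9, 1681] ∖ {P}; INH-type e = 10·l on [839, ∞)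
    refine ⟨fun hZ hH hne hloc => ?_, fun hL hloc => ?_⟩
    · exact GenuineK.not_pilotKummerCompatHull_chosen_triple_1025227_typeband_of_five hl hZ hH hne T hloc
    · rcases le_or_gt 841 l with hB | hB
      · exact WRow.licence_triple_1025227_typeband_e10 hl hB T hloc
      · exact WRow.licence_triple_1025227_typelevels_e10 hl (WRow.n3TypeSplit_inhLevel_1025227 hl hL hB) T hloc

end Summit.ABC.IUTFork.Conditional

end
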